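import Summits.CriticalPhenomena.CardyFormulaZ2.Theorems.CardySusyWardParafermionFamiliesToSLESixAnchorMomentTerms
import Summits.CriticalPhenomena.CardyFormulaZ2.Theorems.CardySusyWardParafermionFamiliesToSLESixMomentIdentity
import Summits.CriticalPhenomena.CardyFormulaZ2.Theorems.CardySusyWardParafermionFamiliesToSLESixAnchorDataFamily

/-!
# The concrete anchor family (skeleton r4 of line `strip-anchored-vertex-normalisation`,
# crux stmt-CriticalPhenomena-10814), XII: the boundary first moment of `anchorData` — ASSEMBLY

Registered stub `stub_anchorMoment_of_IP` of the skeleton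
`Cruxes/ParafermionFamiliesToSLESix/Lines/strip_anchored_vertex_normalisation.lean` (r4): under
Ikhlef–Ponsaing's strip law, along the concrete admissible family `anchorData` of the diagonal square
`anchorDomain` (`IsFamily`: `stub_anchorData_isFamily`), eventually in the mesh `δ`,
`‖wallPlainSum − 2(1−i)·momentSum‖ ≥ c' δ^{-5/3}`.

The proof (`AnchorMoment.lower_bound` + numerics), at level `L` (`L δ < 2 ≤ (L + 1) δ`, `E = anchorData δ`):
* both `finsum`s are finite sums over the wall corners `q = ((x,i),k)` (`TotalSmall.finite_random`,
  `MomentIdentity.finsum_ite_eq_sum`), so `Z = W − 2(1−i)M = Σ_q (G_q − 2(1−i) conj(ẑ) coeff_k G_q)` and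
  `‖Z‖ ≥ Φ(Z) = (Re Z + Im Z)/2 = Σ_q ψ(q)` (`AnchorCone.psi_eq`, `re_add_im_div_two_le_norm`);
* the `≤ 5832` corners of the vertex regions contribute `≥ −(4(L+1)+1)` each (`AnchorCount.card_exc_le`,
  `AnchorTerms.psi_ge_exc_of_mem`);
* every other corner contributes `≥ b(q)` (`AnchorTerms.psi_ge_regular`): the horizontal free-side corners
  of the window `t ∈ [L/4, 3(L/4) − 3]` (`AnchorCount.window_mem/card_window`) give the MASS
  `≥ (L/4) · (L/2) · c L^{-1/3}` by S5's landed `touchProb_lower` (Ikhlef–Ponsaing + RSW, the hypothesis), the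
  two upper-left families are re-indexed by their face (`AnchorCount.UL_zero_eq/UL_one_eq`) and paired
  (`stub_anchorMomentCone`, `AnchorTerms.UL_form_nonneg`) into a nonnegative total, and the rest is `≥ 0`;
* numerics: `(c/8) L^{5/3} − 29160 L ≥ (c/16) δ^{-5/3}` once `L^{2/3} ≥ 466560/c` and `L ≥ 1/δ`
  (`numerics`), and "`L` large" is "`δ` small" (`S5.anchor_geometry` along `anchorData`).
-/

noncomputable section

namespace Summit.CriticalPhenomena.CardyFormulaZ2.Theorems.ParafermionFamiliesToSLESix.StripAnchored

open MeasureTheory Filter Set Metric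
open scoped Topology BigOperators
open Literature.Probability.LatticeModels
open Literature.Probability.Percolation (bondPercolation half BondConfig)
open Literature.Barriers.CriticalPhenomena.HalfCRGreen (coeff twin)
open Summit.CriticalPhenomena.CardyFormulaZ2.Theorems.ParafermionPrecompact.Negative (IsFamily)
open Summit.CriticalPhenomena.CardyFormulaZ2.Cruxes.EdgePrecompact.QkzStripBoundaryArm (cornerObs)
open Literature.Probability.LatticeModels.DiscreteDobrushin (startCorner exitTime)
open S5 (anchorDomain)

namespace AnchorMoment

variable {δ : ℝ} {L : ℤ}

section Level

variable (hδ : 0 < δ) (hLδ : (L : ℝ) * δ < 2) (hL1 : 2 ≤ ((L : ℝ) + 1) * δ) (hL : 16 ≤ L)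
  (hE : (anchorData δ).IsZdAdmissible)

/-- The touch probability `P(w ↔ A)` of the site `w` (the free-side mass). -/
local notation3 "τA[" w "]" => (bondPercolation (zdGraph 2) half).real
  {ω : BondConfig (Site 2) | ∃ a ∈ (anchorData δ).zdArcA,
    (SimpleGraph.fromEdgeSet ((anchorData δ).bcBondConfig ω)).Reachable w a}

/-- The swing probability of the wired face `F` (the exploration visits the dart `(F, 0)`). -/
local notation3 "σS[" F "]" => (bondPercolation (zdGraph 2) half).real
  {ω : BondConfig (Site 2) | ∃ n < exitTime hE ω,
    cornerOrbit ((anchorData δ).bcBondConfig ω) (startCorner hE) n = (F, 0)}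

/-- The wall term `conj ẑ_p · coeff i k · G(p,k)`, `q = (p, k)`. -/
local notation3 "wt[" q "]" => (starRingEnd ℂ) (latticePos (q : (Site 2 × Fin 2) × Fin 4).1) *
  coeff Complex.I (q : (Site 2 × Fin 2) × Fin 4).2 *
    G (anchorData δ) δ (q : (Site 2 × Fin 2) × Fin 4).1 (q : (Site 2 × Fin 2) × Fin 4).2

/-- The wall-corner functional `ψ(q) = (Re G + Im G)/2 − 2 Im(conj ẑ · coeff i k · G)`, `q = (p, k)`. -/
local notation3 "ψ[" q "]" =>
  ((G (anchorData δ) δ (q : (Site 2 × Fin 2) × Fin 4).1 (q : (Site 2 × Fin 2) × Fin 4).2).re +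
    (G (anchorData δ) δ (q : (Site 2 × Fin 2) × Fin 4).1 (q : (Site 2 × Fin 2) × Fin 4).2).im) / 2 -
  2 * ((starRingEnd ℂ) (latticePos (q : (Site 2 × Fin 2) × Fin 4).1) * coeff Complex.I (q : (Site 2 × Fin 2) × Fin 4).2 *
    G (anchorData δ) δ (q : (Site 2 × Fin 2) × Fin 4).1 (q : (Site 2 × Fin 2) × Fin 4).2).im

/-- The free-side part of the lower bound `b(q)`. -/
local notation3 "bb₁[" q "]" =>
  (if (q : (Site 2 × Fin 2) × Fin 4).1.2 = 0 ∧ (q : (Site 2 × Fin 2) × Fin 4).2 = 1 then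
    (L : ℝ) / 2 * τA[(q : (Site 2 × Fin 2) × Fin 4).1.1 + Pi.single 0 1] else 0)

/-- The horizontal upper-left part of the lower bound `b(q)`. -/
local notation3 "bb₅[" q "]" =>
  (if (q : (Site 2 × Fin 2) × Fin 4).1.2 = 0 ∧ (q : (Site 2 × Fin 2) × Fin 4).2 = 0 then
    σS[(q : (Site 2 × Fin 2) × Fin 4).1.1] * ((((q : (Site 2 × Fin 2) × Fin 4).1.1 1 : ℤ) : ℝ) -
      Real.sqrt 3 * ((((q : (Site 2 × Fin 2) × Fin 4).1.1 0 : ℤ) : ℝ) + 1 / 2)) else 0)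

/-- The vertical upper-left part of the lower bound `b(q)`. -/
local notation3 "bb₆[" q "]" =>
  (if (q : (Site 2 × Fin 2) × Fin 4).1.2 = 1 ∧ (q : (Site 2 × Fin 2) × Fin 4).2 = 0 then
    -(σS[(q : (Site 2 × Fin 2) × Fin 4).1.1 - Pi.single 0 1] *
      (Real.sqrt 3 * (((q : (Site 2 × Fin 2) × Fin 4).1.1 0 : ℤ) : ℝ) +
        ((((q : (Site 2 × Fin 2) × Fin 4).1.1 1 : ℤ) : ℝ) + 1 / 2))) else 0)

/-! ## The three pieces of the regular sum -/

variable {T : Finset ((Site 2 × Fin 2) × Fin 4)}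
  (hT : ∀ q, q ∈ T ↔ IsRandomMV (anchorData δ) q.1 ∧ ¬ IsRandomMV (anchorData δ) (twin q.1.1 q.1.2 q.2))

include hδ hLδ hL1 hL hT in
/-- **The mass.** Over the regular corners, the free-side part of `b` is at least
`#window · (L/2) · c L^{-1/3} ≥ (L/4) · (L/2) · c L^{-1/3}`: the window corners are regular horizontal
free-side corners (`AnchorCount.window_mem`), `b₁ ≥ 0` everywhere (`AnchorTerms.mass_nonneg`), and on the
window `P(w ↔ A) ≥ c L^{-1/3}` (the hypothesis `hmass`, S5's `touchProb_lower`). [folklore] -/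
theorem mass_le {c : ℝ} (hc : 0 ≤ c)
    (hmass : ∀ w : Site 2, w 0 + w 1 = L - 2 → 2 * |w 0 - w 1| ≤ L + 2 →
      c * (L : ℝ) ^ (-(1:ℝ) / 3) ≤ τA[w]) :
    (L : ℝ) / 4 * ((L : ℝ) / 2 * (c * (L : ℝ) ^ (-(1:ℝ) / 3))) ≤
      ∑ q ∈ T.filter (fun q => ¬ (L - 8 ≤ |q.1.1 0 + q.1.1 1| ∧ L - 8 ≤ |q.1.1 0 - q.1.1 1|)), bb₁[q] := by
  classical
  rw [← Finset.sum_filter]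
  set I : Finset ℤ := Finset.Icc (L / 4) (3 * (L / 4) - 3) with hI
  set φ : ℤ → (Site 2 × Fin 2) × Fin 4 := fun t => (((![t, L - 3 - t] : Site 2), (0 : Fin 2)), (1 : Fin 4))
    with hφ
  have hsub : I.image φ ⊆ (T.filter (fun q => ¬ (L - 8 ≤ |q.1.1 0 + q.1.1 1| ∧ L - 8 ≤ |q.1.1 0 - q.1.1 1|))).filter
      (fun q => q.1.2 = 0 ∧ q.2 = 1) := by
    intro q hq
    obtain ⟨t, ht, rfl⟩ := Finset.mem_image.1 hq
    obtain ⟨⟨hmem, hnreg⟩, -⟩ := AnchorCount.window_mem hδ hLδ hL1 hL hT ht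
    exact Finset.mem_filter.2 ⟨Finset.mem_filter.2 ⟨hmem, hnreg⟩, rfl, rfl⟩
  have hL0 : (0 : ℝ) ≤ L := by exact_mod_cast (show (0 : ℤ) ≤ L by omega)
  have hconst : 0 ≤ (L : ℝ) / 2 * (c * (L : ℝ) ^ (-(1:ℝ) / 3)) := by positivity
  calc (L : ℝ) / 4 * ((L : ℝ) / 2 * (c * (L : ℝ) ^ (-(1:ℝ) / 3)))
      ≤ (I.card : ℝ) * ((L : ℝ) / 2 * (c * (L : ℝ) ^ (-(1:ℝ) / 3))) :=
        mul_le_mul_of_nonneg_right (AnchorCount.card_window (L := L) hL) hconst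
    _ = ∑ t ∈ I, (L : ℝ) / 2 * (c * (L : ℝ) ^ (-(1:ℝ) / 3)) := by rw [Finset.sum_const, nsmul_eq_mul]
    _ ≤ ∑ t ∈ I, (L : ℝ) / 2 * τA[(φ t).1.1 + Pi.single 0 1] := by
        refine Finset.sum_le_sum fun t ht => mul_le_mul_of_nonneg_left ?_ (by positivity)
        obtain ⟨-, h1, h2⟩ := AnchorCount.window_mem hδ hLδ hL1 hL hT ht
        exact hmass _ h1 h2
    _ = ∑ q ∈ I.image φ, (L : ℝ) / 2 * τA[q.1.1 + Pi.single 0 1] := by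
        rw [Finset.sum_image ((AnchorCount.injective_param (fun t => t) (fun t => L - 3 - t) 0 1).2.injOn)]
    _ ≤ _ := Finset.sum_le_sum_of_subset_of_nonneg hsub fun q _ _ => AnchorTerms.mass_nonneg (δ := δ) hL _

include hδ hLδ hL1 hL hT in
/-- **The upper-left pairing.** Over the regular corners, the two upper-left parts of `b` have nonnegative
total: re-indexed by the face `F = (t-(L-1), t)` (`AnchorCount.UL_zero_eq/UL_one_eq`), the horizontal
forms (`t ∈ [4, L-5]`, each `≥ 0` by `AnchorTerms.UL_form_nonneg`) dominate the vertical ones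
(`t ∈ [4, L-6]`) face by face (`stub_anchorMomentCone`, `F₀ = t-(L-1) ≤ -1`). [folklore] -/
theorem pairing_le :
    0 ≤ ∑ q ∈ T.filter (fun q => ¬ (L - 8 ≤ |q.1.1 0 + q.1.1 1| ∧ L - 8 ≤ |q.1.1 0 - q.1.1 1|)), bb₅[q] +
      ∑ q ∈ T.filter (fun q => ¬ (L - 8 ≤ |q.1.1 0 + q.1.1 1| ∧ L - 8 ≤ |q.1.1 0 - q.1.1 1|)), bb₆[q] := by
  classical
  rw [← Finset.sum_filter, ← Finset.sum_filter]
  have e5 : (T.filter (fun q => ¬ (L - 8 ≤ |q.1.1 0 + q.1.1 1| ∧ L - 8 ≤ |q.1.1 0 - q.1.1 1|))).filter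
      (fun q => q.1.2 = 0 ∧ q.2 = 0) =
      (Finset.Icc 4 (L - 5)).image (fun t : ℤ => (((![t - (L - 1), t] : Site 2), (0 : Fin 2)), (0 : Fin 4))) :=
    AnchorCount.UL_zero_eq hδ hLδ hL1 hL hT _ (fun q => by simp only [Finset.mem_filter])
  have e6 : (T.filter (fun q => ¬ (L - 8 ≤ |q.1.1 0 + q.1.1 1| ∧ L - 8 ≤ |q.1.1 0 - q.1.1 1|))).filter
      (fun q => q.1.2 = 1 ∧ q.2 = 0) =
      (Finset.Icc 4 (L - 6)).image (fun t : ℤ => (((![t - (L - 2), t] : Site 2), (1 : Fin 2)), (0 : Fin 4))) :=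
    AnchorCount.UL_one_eq hδ hLδ hL1 hL hT _ (fun q => by simp only [Finset.mem_filter])
  rw [e5, e6, Finset.sum_image ((AnchorCount.injective_param (fun t => t - (L - 1)) (fun t => t) 0 0).1.injOn),
    Finset.sum_image ((AnchorCount.injective_param (fun t => t - (L - 2)) (fun t => t) 1 0).1.injOn)]
  -- drop the last horizontal face `t = L - 5`
  have hsub : Finset.Icc 4 (L - 6) ⊆ Finset.Icc 4 (L - 5) :=
    Finset.Icc_subset_Icc le_rfl (by omega)
  have h5 : ∑ t ∈ Finset.Icc 4 (L - 6), σS[(![t - (L - 1), t] : Site 2)] *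
      ((((![t - (L - 1), t] : Site 2) 1 : ℤ) : ℝ) - Real.sqrt 3 * ((((![t - (L - 1), t] : Site 2) 0 : ℤ) : ℝ) + 1 / 2)) ≤
      ∑ t ∈ Finset.Icc 4 (L - 5), σS[(![t - (L - 1), t] : Site 2)] *
      ((((![t - (L - 1), t] : Site 2) 1 : ℤ) : ℝ) - Real.sqrt 3 * ((((![t - (L - 1), t] : Site 2) 0 : ℤ) : ℝ) + 1 / 2)) :=
    Finset.sum_le_sum_of_subset_of_nonneg hsub fun t ht _ => by
      have h := Finset.mem_Icc.1 ht
      exact AnchorTerms.UL_form_nonneg (hE := hE) ⟨by omega, h.2⟩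
  dsimp only
  refine le_trans ?_ (add_le_add h5 le_rfl)
  rw [← Finset.sum_add_distrib]
  refine Finset.sum_nonneg fun t ht => ?_
  rw [Finset.mem_Icc] at ht
  have hvec : (![t - (L - 2), t] : Site 2) - Pi.single 0 1 = ![t - (L - 1), t] := by
    ext j; fin_cases j
    · simp; ring
    · simp
  rw [hvec]
  simp only [Matrix.cons_val_zero, Matrix.cons_val_one, Matrix.cons_val_fin_one]
  have ht6 : (t : ℝ) ≤ (L : ℝ) - 6 := by exact_mod_cast (show t ≤ L - 6 by omega)
  have key := stub_anchorMomentCone (σS[(![t - (L - 1), t] : Site 2)]) ((t : ℝ) - ((L : ℝ) - 1)) t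
    measureReal_nonneg (by linarith)
  push_cast
  ring_nf at key ⊢
  linarith

/-! ## The deterministic lower bound at level `L` -/

include hδ hLδ hL1 hL hE in
/-- **The boundary first moment at level `L`, bounded below.** For `0 < δ`, `L δ < 2 ≤ (L+1) δ`, `16 ≤ L`,
admissible `anchorData δ`, and the window touch bound `P(w ↔ A) ≥ c L^{-1/3}`:
`(L/4)(L/2) c L^{-1/3} − (4(L+1)+1) · 5832 ≤ ‖wallPlainSum − 2(1−i) momentSum‖`. [folklore] -/
theorem lower_bound {c : ℝ} (hc : 0 ≤ c)
    (hmass : ∀ w : Site 2, w 0 + w 1 = L - 2 → 2 * |w 0 - w 1| ≤ L + 2 →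
      c * (L : ℝ) ^ (-(1:ℝ) / 3) ≤ τA[w]) :
    (L : ℝ) / 4 * ((L : ℝ) / 2 * (c * (L : ℝ) ^ (-(1:ℝ) / 3))) - (4 * ((L : ℝ) + 1) + 1) * 5832 ≤
      ‖wallPlainSum (anchorData δ) δ - 2 * (1 - Complex.I) * momentSum (anchorData δ) δ‖ := by
  classical
  -- the wall set
  obtain ⟨S, hS⟩ : ∃ S : Finset (Site 2 × Fin 2), ∀ p, p ∈ S ↔ IsRandomMV (anchorData δ) p :=
    ⟨(TotalSmall.finite_random hE).toFinset, fun p => by simp⟩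
  set T : Finset ((Site 2 × Fin 2) × Fin 4) := (S ×ˢ (Finset.univ : Finset (Fin 4))).filter
    (fun q => ¬ IsRandomMV (anchorData δ) (twin q.1.1 q.1.2 q.2)) with hTdef
  have hT : ∀ q, q ∈ T ↔ IsRandomMV (anchorData δ) q.1 ∧ ¬ IsRandomMV (anchorData δ) (twin q.1.1 q.1.2 q.2) := by
    intro q
    simp only [hTdef, Finset.mem_filter, Finset.mem_product, Finset.mem_univ, and_true, hS]
  -- the two `finsum`s as sums over the wall set
  have hM : momentSum (anchorData δ) δ = ∑ q ∈ T, wt[q] := by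
    rw [momentSum, MomentIdentity.finsum_ite_eq_sum S hS, hTdef, Finset.sum_filter, Finset.sum_product]
    refine Finset.sum_congr rfl fun p _ => Finset.sum_congr rfl fun k _ => ?_
    by_cases h : IsRandomMV (anchorData δ) (twin p.1 p.2 k) <;> simp [h]
  have hW : wallPlainSum (anchorData δ) δ = ∑ q ∈ T, G (anchorData δ) δ q.1 q.2 := by
    rw [wallPlainSum, MomentIdentity.finsum_ite_eq_sum S hS, hTdef, Finset.sum_filter, Finset.sum_product]
    refine Finset.sum_congr rfl fun p _ => Finset.sum_congr rfl fun k _ => ?_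
    by_cases h : IsRandomMV (anchorData δ) (twin p.1 p.2 k) <;> simp [h]
  have hZ : wallPlainSum (anchorData δ) δ - 2 * (1 - Complex.I) * momentSum (anchorData δ) δ =
      ∑ q ∈ T, (G (anchorData δ) δ q.1 q.2 - 2 * (1 - Complex.I) * wt[q]) := by
    rw [hM, hW, Finset.mul_sum, ← Finset.sum_sub_distrib]
  -- `Φ(Z) = Σ ψ`
  have hΦ : ((wallPlainSum (anchorData δ) δ - 2 * (1 - Complex.I) * momentSum (anchorData δ) δ).re +
      (wallPlainSum (anchorData δ) δ - 2 * (1 - Complex.I) * momentSum (anchorData δ) δ).im) / 2 =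
      ∑ q ∈ T, ψ[q] := by
    rw [hZ, Complex.re_sum, Complex.im_sum, ← Finset.sum_add_distrib, Finset.sum_div]
    exact Finset.sum_congr rfl fun q _ => AnchorCone.psi_eq _ _
  refine le_trans ?_ (AnchorCone.re_add_im_div_two_le_norm _)
  rw [hΦ, ← Finset.sum_filter_add_sum_filter_not T
    (fun q => L - 8 ≤ |q.1.1 0 + q.1.1 1| ∧ L - 8 ≤ |q.1.1 0 - q.1.1 1|)]
  -- the vertex regions
  have hexc : -((4 * ((L : ℝ) + 1) + 1) * 5832) ≤
      ∑ q ∈ T.filter (fun q => L - 8 ≤ |q.1.1 0 + q.1.1 1| ∧ L - 8 ≤ |q.1.1 0 - q.1.1 1|), ψ[q] := by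
    have hcard := AnchorCount.card_exc_le hδ hLδ hL1 hL hT
      (T.filter (fun q => L - 8 ≤ |q.1.1 0 + q.1.1 1| ∧ L - 8 ≤ |q.1.1 0 - q.1.1 1|))
      (fun q hq => by simpa [Finset.mem_filter] using hq)
    have hsum := Finset.card_nsmul_le_sum
      (T.filter (fun q => L - 8 ≤ |q.1.1 0 + q.1.1 1| ∧ L - 8 ≤ |q.1.1 0 - q.1.1 1|)) (fun q => ψ[q])
      (-(4 * ((L : ℝ) + 1) + 1)) (fun q hq => AnchorTerms.psi_ge_exc_of_mem hδ hLδ hL1 hL hT (Finset.mem_filter.1 hq).1)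
    rw [nsmul_eq_mul] at hsum
    refine le_trans ?_ hsum
    have hcard' : ((T.filter (fun q => L - 8 ≤ |q.1.1 0 + q.1.1 1| ∧ L - 8 ≤ |q.1.1 0 - q.1.1 1|)).card : ℝ) ≤
        5832 := by exact_mod_cast hcard
    have hL0 : (0 : ℝ) ≤ L := by exact_mod_cast (show (0 : ℤ) ≤ L by omega)
    nlinarith
  -- the regular corners
  have hreg : (L : ℝ) / 4 * ((L : ℝ) / 2 * (c * (L : ℝ) ^ (-(1:ℝ) / 3))) ≤
      ∑ q ∈ T.filter (fun q => ¬ (L - 8 ≤ |q.1.1 0 + q.1.1 1| ∧ L - 8 ≤ |q.1.1 0 - q.1.1 1|)), ψ[q] := by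
    have step : ∑ q ∈ T.filter (fun q => ¬ (L - 8 ≤ |q.1.1 0 + q.1.1 1| ∧ L - 8 ≤ |q.1.1 0 - q.1.1 1|)),
        (bb₁[q] + bb₅[q] + bb₆[q]) ≤
        ∑ q ∈ T.filter (fun q => ¬ (L - 8 ≤ |q.1.1 0 + q.1.1 1| ∧ L - 8 ≤ |q.1.1 0 - q.1.1 1|)), ψ[q] :=
      Finset.sum_le_sum fun q hq => AnchorTerms.psi_ge_regular hδ hLδ hL1 hL hE hT (Finset.mem_filter.1 hq).1
        (Finset.mem_filter.1 hq).2
    refine le_trans ?_ step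
    rw [Finset.sum_add_distrib, Finset.sum_add_distrib]
    have h1 := mass_le hδ hLδ hL1 hL hT hc hmass
    have h56 := pairing_le hδ hLδ hL1 hL hE hT
    linarith
  linarith

end Level

/-! ## Numerics -/

/-- `x ^ (2/3) = x · x^{-1/3}` and `x ^ (5/3) = x² · x^{-1/3}` for `x > 0`. [folklore] -/
theorem rpow_thirds {x : ℝ} (hx : 0 < x) :
    x ^ ((2:ℝ) / 3) = x * x ^ (-(1:ℝ) / 3) ∧ x ^ ((5:ℝ) / 3) = x ^ 2 * x ^ (-(1:ℝ) / 3) := by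
  constructor
  · rw [show (2:ℝ) / 3 = 1 + -(1:ℝ) / 3 by norm_num, Real.rpow_add hx, Real.rpow_one]
  · rw [show (5:ℝ) / 3 = 2 + -(1:ℝ) / 3 by norm_num, Real.rpow_add hx, Real.rpow_two]

/-- **Numerics.** If `L^{2/3} ≥ 466560 / c` (guaranteed by `L ≥ (466560/c)^{3/2}`), `L ≥ 5`, `δ ≤ 1` and
`2 ≤ (L + 1) δ` (so `L ≥ 1/δ`), then
`(c/16) δ^{-5/3} ≤ (L/4)(L/2) c L^{-1/3} − (4(L+1)+1) · 5832`. [folklore] -/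
theorem numerics {c δ : ℝ} {L : ℤ} (hc : 0 < c) (hδ : 0 < δ) (hδ1 : δ ≤ 1) (hL1 : 2 ≤ ((L : ℝ) + 1) * δ)
    (hL5 : (5 : ℝ) ≤ L) (hK : (466560 / c) ^ ((3:ℝ) / 2) ≤ (L : ℝ)) :
    c / 16 * δ ^ (-(5:ℝ) / 3) ≤
      (L : ℝ) / 4 * ((L : ℝ) / 2 * (c * (L : ℝ) ^ (-(1:ℝ) / 3))) - (4 * ((L : ℝ) + 1) + 1) * 5832 := by
  have hL0 : (0 : ℝ) < L := by linarith
  obtain ⟨h23, h53⟩ := rpow_thirds hL0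
  set u : ℝ := (L : ℝ) ^ (-(1:ℝ) / 3) with hu
  have hu0 : 0 < u := Real.rpow_pos_of_pos hL0 _
  -- `c · L^{2/3} ≥ 466560`
  have hK0 : 0 ≤ 466560 / c := by positivity
  have hK' : 466560 / c ≤ (L : ℝ) * u := by
    rw [← h23]
    have := Real.rpow_le_rpow (by positivity) hK (show (0:ℝ) ≤ 2 / 3 by norm_num)
    rwa [← Real.rpow_mul hK0, show (3:ℝ) / 2 * (2 / 3) = 1 by norm_num, Real.rpow_one] at this
  have hcLu : 466560 ≤ c * ((L : ℝ) * u) := by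
    have := mul_le_mul_of_nonneg_left hK' hc.le
    rwa [mul_div_cancel₀ _ hc.ne'] at this
  -- the junk is at most half the mass
  have hjunk : (4 * ((L : ℝ) + 1) + 1) * 5832 ≤ c / 16 * ((L : ℝ) ^ 2 * u) := by
    have h1 : (4 * ((L : ℝ) + 1) + 1) * 5832 ≤ 29160 * L := by nlinarith
    have h2 : 29160 * (L : ℝ) ≤ c / 16 * ((L : ℝ) ^ 2 * u) := by nlinarith
    linarith
  -- `L^{5/3} ≥ δ^{-5/3}`
  have hLδ' : 1 / δ ≤ (L : ℝ) := by
    rw [div_le_iff₀ hδ]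
    nlinarith
  have hpow : δ ^ (-(5:ℝ) / 3) ≤ (L : ℝ) ^ 2 * u := by
    rw [← h53, show (-(5:ℝ) / 3) = -((5:ℝ) / 3) by ring, Real.rpow_neg hδ.le, ← Real.inv_rpow hδ.le,
      inv_eq_one_div]
    exact Real.rpow_le_rpow (by positivity) hLδ' (by norm_num)
  have hmass : (L : ℝ) / 4 * ((L : ℝ) / 2 * (c * u)) = c / 8 * ((L : ℝ) ^ 2 * u) := by ring
  rw [hmass]
  nlinarith [mul_le_mul_of_nonneg_left hpow (show 0 ≤ c / 16 by positivity)]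

end AnchorMoment

open AnchorMoment in
/-- **Registered stub `stub_anchorMoment_of_IP`** (line `strip-anchored-vertex-normalisation`, skeleton r4):
under Ikhlef–Ponsaing's strip law, along the concrete admissible family `anchorData` of the diagonal square
`anchorDomain` (`stub_anchorData_isFamily`) the boundary first moment is of order `δ^{-5/3}`:
eventually in `δ`, `(c/16) δ^{-5/3} ≤ ‖wallPlainSum − 2(1−i)·momentSum‖`, `c` the constant of S5's
`touchProb_lower`.  Eventually (`S5.anchor_geometry`, `δ < 1/(L₀ + K + 40)`): the level `L` exceeds `L₀`,
`K = (466560/c)^{3/2}` and `16`, the window touch probabilities are `≥ c L^{-1/3}` (`touchProb_lower`), and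
`lower_bound` + `numerics` conclude. [folklore] -/
theorem stub_anchorMoment_of_IP : Literature.Probability.Percolation.IkhlefPonsaingFirstPassage → ∃ Λ : ℝ → DiscreteDobrushin, IsFamily anchorDomain Λ ∧ ∃ c : ℝ, 0 < c ∧ ∀ᶠ δ in 𝓝[>] (0:ℝ), c * δ ^ (-(5:ℝ) / 3) ≤ ‖wallPlainSum (Λ δ) δ - 2 * (1 - Complex.I) * momentSum (Λ δ) δ‖ := by
  intro hIP
  obtain ⟨c, hc, L₀, harm⟩ := S5.touchProb_lower hIP
  refine ⟨anchorData, stub_anchorData_isFamily, c / 16, by positivity, ?_⟩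
  set K : ℝ := (466560 / c) ^ ((3:ℝ) / 2) with hKdef
  have hK0 : 0 ≤ K := by positivity
  have hδ₁ : (0:ℝ) < 1 / ((L₀ : ℝ) + K + 40) := by positivity
  filter_upwards [S5.anchor_geometry stub_anchorData_isFamily, Ioo_mem_nhdsGT hδ₁] with δ hgeom hδI
  obtain ⟨hδ0, hδ1⟩ := hδI
  obtain ⟨L, -, hLδ, hL1, hE, -, -, hmesh, hadj, hbd, -, -, harcA⟩ := hgeom
  -- `L` is large
  have hbig : (L₀ : ℝ) + K + 40 < (L : ℝ) + 1 := by
    have h1 : δ * ((L₀ : ℝ) + K + 40) < 1 := by rwa [lt_div_iff₀ (by positivity)] at hδ1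
    by_contra hle
    rw [not_lt] at hle
    have := mul_le_mul_of_nonneg_right hle hδ0.le
    nlinarith
  have hL₀' : (L₀ : ℝ) ≤ L := by linarith [(Nat.cast_nonneg L₀ : (0:ℝ) ≤ L₀)]
  have hL₀L : (L₀ : ℤ) ≤ L := by exact_mod_cast hL₀'
  have hL16' : (16 : ℝ) ≤ L := by linarith [(Nat.cast_nonneg L₀ : (0:ℝ) ≤ L₀)]
  have hL16 : (16 : ℤ) ≤ L := by exact_mod_cast hL16'
  have hKL : K ≤ L := by linarith [(Nat.cast_nonneg L₀ : (0:ℝ) ≤ L₀)]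
  have hδle : δ ≤ 1 := by
    refine (hδ1.trans_le ?_).le
    rw [div_le_one (by positivity)]
    linarith [(Nat.cast_nonneg L₀ : (0:ℝ) ≤ L₀)]
  -- the window touch bound along `anchorData δ`
  have hmass : ∀ w : Site 2, w 0 + w 1 = L - 2 → 2 * |w 0 - w 1| ≤ L + 2 →
      c * (L : ℝ) ^ (-(1:ℝ) / 3) ≤ (bondPercolation (zdGraph 2) half).real
        {ω : BondConfig (Site 2) | ∃ a ∈ (anchorData δ).zdArcA,
          (SimpleGraph.fromEdgeSet ((anchorData δ).bcBondConfig ω)).Reachable w a} :=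
    fun w hw hdw => harm (anchorData δ) L hL₀L hE hmesh hadj hbd harcA w hw hdw
  exact (numerics hc hδ0 hδle hL1 (by linarith) hKL).trans (lower_bound hδ0 hLδ hL1 hL16 hE hc.le hmass)

end Summit.CriticalPhenomena.CardyFormulaZ2.Theorems.ParafermionFamiliesToSLESix.StripAnchored

end
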